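import Mathlib.Analysis.Complex.HasPrimitives
import Mathlib.Analysis.Complex.UpperHalfPlane.Basic
import HarnessLib

/-!
# Stub `stub_halfPlanePrimitive` of line `birth`, crux `CardyWickAnisotropy.AnisotropicBoxCardy`
(stmt-CriticalPhenomena-14309): holomorphic functions on the upper half-plane have primitives

Generic complex analysis (Cauchy–Goursat on the convex, hence simply connected, open upper
half-plane).  Proof: Mathlib's Morera/primitive machinery on discs
(`DifferentiableOn.isExactOn_ball`, `Complex.IsConservativeOn.hasDerivAt_wedgeIntegral`) glued
along the discs `B(iR, R) ↑ ℍ` (cf. the tree's `ObliqueRBMWedgeHalfPlane.hasDerivAt_phi`).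
-/

namespace Summit.CriticalPhenomena.CardyFormulaZ2.Theorems

noncomputable section

open Set Filter Topology Complex MeasureTheory intervalIntegral Metric
open scoped Real Interval

-- adapted from Literature/Probability/RandomPlanarGeometry/ObliqueRBMWedgeHalfPlane.lean
-- (`intervalIntegrable_phiKernel_vert`, `phi_eq_wedgeIntegral`, `mem_ball_mul_I`,
-- `ball_mul_I_subset`, `hasDerivAt_phi`), made generic in the holomorphic function `f`.

/-- A function holomorphic on `ℍ` is interval integrable along any vertical segment
`{x + iy : y ∈ [a, b]}` with `a, b > 0`. -/
private theorem halfPlanePrimitive_intervalIntegrable_vert {f : ℂ → ℂ}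
    (hf : DifferentiableOn ℂ f {τ : ℂ | 0 < τ.im}) (x : ℝ) {a b : ℝ} (ha : 0 < a) (hb : 0 < b) :
    IntervalIntegrable (fun y : ℝ ↦ f (x + y * I)) volume a b := by
  refine ContinuousOn.intervalIntegrable ?_
  intro y hy
  have hy0 : 0 < y := by
    rcases le_total a b with h | h
    · rw [uIcc_of_le h] at hy; exact ha.trans_le hy.1
    · rw [uIcc_of_ge h] at hy; exact hb.trans_le hy.1
  have hmem : ((x : ℂ) + y * I) ∈ {τ : ℂ | 0 < τ.im} := by simp [hy0]
  have hcont : ContinuousAt f ((x : ℂ) + y * I) :=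
    hf.continuousOn.continuousAt (UpperHalfPlane.isOpen_upperHalfPlaneSet.mem_nhds hmem)
  exact (ContinuousAt.comp (f := fun y : ℝ ↦ (x : ℂ) + y * I) hcont
    (by fun_prop : Continuous fun y : ℝ ↦ (x : ℂ) + y * I).continuousAt).continuousWithinAt

/-- **Change of base point** for the wedge integral of a function holomorphic on `ℍ`:
`wedge_i(w) = wedge_{iR}(w) + i ∫₁^R f(iy) dy` for `w ∈ ℍ`, `R > 0`
(Cauchy's theorem on the rectangle `[0, re w] × [1, R] ⊆ ℍ`). -/
private theorem halfPlanePrimitive_wedge_eq {f : ℂ → ℂ}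
    (hf : DifferentiableOn ℂ f {τ : ℂ | 0 < τ.im}) {R : ℝ} (hR : 0 < R) {w : ℂ} (hw : 0 < w.im) :
    wedgeIntegral I w f
      = wedgeIntegral (R * I) w f + I * ∫ y in (1:ℝ)..R, f ((0:ℝ) + y * I) := by
  have hrect : Rectangle I (w.re + R * I) ⊆ {τ : ℂ | 0 < τ.im} := by
    intro z hz
    rw [Rectangle, mem_reProdIm] at hz
    have h2 := hz.2
    simp only [I_im, add_im, ofReal_im, mul_im, ofReal_re, I_re, mul_zero, zero_add, mul_one,
      add_zero] at h2
    show 0 < z.im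
    rcases le_total 1 R with h | h
    · rw [uIcc_of_le h] at h2; linarith [h2.1]
    · rw [uIcc_of_ge h] at h2; linarith [h2.1]
  have hc := hf.isConservativeOn I (w.re + R * I) hrect
  simp only [Complex.wedgeIntegral, I_re, I_im, add_re, ofReal_re, mul_re, mul_zero,
    ofReal_im, mul_one, sub_self, add_zero, add_im, mul_im, zero_add, smul_eq_mul, ofReal_one,
    one_mul, ofReal_zero] at hc ⊢
  rw [intervalIntegral.integral_symm 0 w.re, intervalIntegral.integral_symm 1 R] at hc
  have hsub := intervalIntegral.integral_interval_sub_left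
    (halfPlanePrimitive_intervalIntegrable_vert hf w.re one_pos hw)
    (halfPlanePrimitive_intervalIntegrable_vert hf w.re one_pos hR)
  linear_combination hc + I * hsub

/-- Every `z ∈ ℍ` lies in the disc `B(iR, R)` with `R = ‖z‖² / im z + 1`. -/
private theorem halfPlanePrimitive_mem_ball {z : ℂ} (hz : 0 < z.im) :
    z ∈ ball ((((‖z‖ ^ 2 / z.im + 1 : ℝ)) : ℂ) * I) (‖z‖ ^ 2 / z.im + 1) := by
  set R : ℝ := ‖z‖ ^ 2 / z.im + 1 with hR
  have hRpos : 0 < R := by positivity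
  rw [mem_ball, dist_eq_norm]
  have hsq : ‖z - (R : ℂ) * I‖ ^ 2 < R ^ 2 := by
    rw [← Complex.normSq_eq_norm_sq (z := z - R * I)]
    have : Complex.normSq (z - (R : ℂ) * I) = z.re * z.re + (z.im - R) * (z.im - R) := by
      rw [Complex.normSq_apply]; simp
    rw [this]
    have hz2 : ‖z‖ ^ 2 = z.re * z.re + z.im * z.im := by
      rw [← Complex.normSq_eq_norm_sq, Complex.normSq_apply]
    have hRim : R * z.im = ‖z‖ ^ 2 + z.im := by rw [hR]; field_simp
    nlinarith
  nlinarith [norm_nonneg (z - (R : ℂ) * I)]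

/-- The discs `B(iR, R)` are contained in `ℍ`. -/
private theorem halfPlanePrimitive_ball_subset (R : ℝ) :
    ball ((R : ℂ) * I) R ⊆ {τ : ℂ | 0 < τ.im} := by
  intro w hw
  rw [mem_ball, dist_eq_norm] at hw
  have h := abs_im_le_norm (w - (R : ℂ) * I)
  simp only [sub_im, mul_im, ofReal_re, I_im, mul_one, ofReal_im, I_re, mul_zero, add_zero] at h
  show 0 < w.im
  have := h.trans_lt hw
  rw [abs_lt] at this
  linarith [this.1]

/-- **Holomorphic functions on the upper half-plane have primitives** (expanded form of the stub
`stub_halfPlanePrimitive` below): every function holomorphic on `ℍ = {τ | 0 < im τ}` is the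
derivative there of some `g : ℂ → ℂ` (namely of the wedge integral of `f` from the base point `i`). -/
theorem halfPlanePrimitive :
    ∀ f : ℂ → ℂ, DifferentiableOn ℂ f {τ : ℂ | 0 < τ.im} →
      ∃ g : ℂ → ℂ, ∀ τ : ℂ, 0 < τ.im → HasDerivAt g (f τ) τ := by
  intro f hf
  refine ⟨fun w ↦ wedgeIntegral I w f, fun z hz ↦ ?_⟩
  -- the wedge integral from the base point `i`; near `z` it differs from the wedge integral
  -- based at `iR` (a primitive on the disc `B(iR, R) ∋ z`, Morera on discs) by a constant
  set R : ℝ := ‖z‖ ^ 2 / z.im + 1 with hR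
  have hRpos : 0 < R := by positivity
  have hzball : z ∈ ball ((R : ℂ) * I) R := halfPlanePrimitive_mem_ball hz
  have hsub : ball ((R : ℂ) * I) R ⊆ {τ : ℂ | 0 < τ.im} := halfPlanePrimitive_ball_subset R
  have hdiff : DifferentiableOn ℂ f (ball ((R : ℂ) * I) R) := hf.mono hsub
  have hderiv : HasDerivAt (fun w ↦ wedgeIntegral ((R : ℂ) * I) w f) (f z) z :=
    hdiff.isConservativeOn.hasDerivAt_wedgeIntegral hdiff.continuousOn hzball
  have hderiv' := hderiv.add_const (I * ∫ y in (1:ℝ)..R, f ((0:ℝ) + y * I))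
  refine hderiv'.congr_of_eventuallyEq ?_
  filter_upwards [UpperHalfPlane.isOpen_upperHalfPlaneSet.mem_nhds hz] with w hw
  exact halfPlanePrimitive_wedge_eq hf hRpos hw

/-- Signature of `stub_halfPlanePrimitive`, verbatim the body of `Sig.stub_halfPlanePrimitive` of the
registered skeleton of crux `AnisotropicBoxCardy` (line `birth`), so that the stub lands under the
registered header `stub_halfPlanePrimitive : Sig.stub_halfPlanePrimitive` and closes the skeleton's
stub by `exact` (the two `Sig` definitions are definitionally equal).  Kept `private` so that sibling
stub files may carry their own copy without a name clash on import; use `halfPlanePrimitive` for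
the expanded statement. -/
private def Sig.stub_halfPlanePrimitive : Prop :=
  ∀ f : ℂ → ℂ, DifferentiableOn ℂ f {τ : ℂ | 0 < τ.im} →
    ∃ g : ℂ → ℂ, ∀ τ : ℂ, 0 < τ.im → HasDerivAt g (f τ) τ

/-- **Stub `stub_halfPlanePrimitive`** (line `birth` of crux `AnisotropicBoxCardy`): every function
holomorphic on `ℍ = {τ | 0 < im τ}` is the derivative there of some `g : ℂ → ℂ`, i.e.
`∀ f : ℂ → ℂ, DifferentiableOn ℂ f {τ : ℂ | 0 < τ.im} →
  ∃ g : ℂ → ℂ, ∀ τ : ℂ, 0 < τ.im → HasDerivAt g (f τ) τ` (see `halfPlanePrimitive`). -/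
theorem stub_halfPlanePrimitive : Sig.stub_halfPlanePrimitive :=
  halfPlanePrimitive

end

end Summit.CriticalPhenomena.CardyFormulaZ2.Theorems
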